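import Mathlib
import Summits.Ventures.PercRepro.TriangleCapOffPairsCount

/-!
# PercRepro — the edges avoiding a pair off a vertex: the per-pair bound with its defect, the summed form,
and the lower bounds on the defect sum from the matching pairs (p3, gen 31; part 1 of the row `m = k + 2`)

TriangleCapOffPairs's per-pair bound `d(x) + d(y) + d(v) ≤ m + 1 + [v ~ x] + [v ~ y]` for `x ~ y` off `v`
counts the edges at `x`, `y` or `v`; the edges at none of them are its defect.  With
`avoid D v p` = the edges of `D` containing neither `v` nor a coordinate of `p`:

* `deg_add_deg_add_deg_add_card_avoid_le` — `d(x) + d(y) + d(v) + |avoid (x, y)| ≤ m + 1 + [v ~ x] + [v ~ y]`;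
* `sum_R_add_sum_avoid_le` — summed over `R = offPairs D v`: `S_R + |R|·d + Y ≤ |R|(m + 1) + 2E₁`, where
  `Y = Σ_{p ∈ R} |avoid p|`;
* `card_filter_T_fst_le_one` / `card_filter_T_snd_le_one` — at most one matching pair (both coordinates in
  `N(v)`) starts, resp. ends, at a given vertex (the matching property);
* `exists_T_avoiding` — with `T ≥ 3` matching pairs every pair `p` off `v` has a matching pair avoiding both its
  coordinates, hence `one_le_card_avoid_of_three_le` and **`card_offPairs_le_sum_avoid_of_three_le`**: `|R| ≤ Y`;
* `two_le_card_avoid_of_six_le` — with `T ≥ 6` every matching pair `p` has two distinct matching edges avoiding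
  it, hence **`two_mul_card_T_le_sum_avoid_of_six_le`**: `2T ≤ Y`.

Axioms: standard.
-/

namespace PercRepro

namespace TriangleCap

namespace C047

open Finset

variable {V : Type*} [Fintype V] [DecidableEq V]

/-- The edges of `D` containing neither `v` nor a coordinate of `p`. -/
def avoid (D : SimpleGraph V) [DecidableRel D.Adj] (v : V) (p : V × V) : Finset (Sym2 V) :=
  D.edgeFinset.filter (fun e => v ∉ e ∧ p.1 ∉ e ∧ p.2 ∉ e)

/-- Membership in `avoid`. -/
theorem mem_avoid (D : SimpleGraph V) [DecidableRel D.Adj] (v : V) (p : V × V) (e : Sym2 V) :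
    e ∈ avoid D v p ↔ e ∈ D.edgeFinset ∧ v ∉ e ∧ p.1 ∉ e ∧ p.2 ∉ e := by
  unfold avoid
  rw [mem_filter]

/-- `avoid` does not see the order of the pair. -/
theorem avoid_swap (D : SimpleGraph V) [DecidableRel D.Adj] (v : V) (p : V × V) :
    avoid D v p.swap = avoid D v p := by
  ext e
  rw [mem_avoid, mem_avoid]
  simp only [Prod.fst_swap, Prod.snd_swap]
  tauto

/-- **The per-pair bound with its defect:** for `x ~ y` off `v`,
`d(x) + d(y) + d(v) + |avoid (x, y)| ≤ m + 1 + [v ~ x] + [v ~ y]`. -/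
theorem deg_add_deg_add_deg_add_card_avoid_le (D : SimpleGraph V) [DecidableRel D.Adj] {v x y : V}
    (h : D.Adj x y) (hx : x ≠ v) (hy : y ≠ v) :
    deg D x + deg D y + deg D v + (avoid D v (x, y)).card ≤
      D.edgeFinset.card + 1 + (if D.Adj v x then 1 else 0) + (if D.Adj v y then 1 else 0) := by
  have h1 := card_union_add_card_inter (D.incidenceFinset x) (D.incidenceFinset y)
  rw [incidenceFinset_inter_of_adj D h, card_singleton] at h1
  have h2 := card_union_add_card_inter (D.incidenceFinset x ∪ D.incidenceFinset y)
    (D.incidenceFinset v)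
  have h3 := card_incidenceFinset_inter_union_le D hx hy
  rw [inter_comm] at h3
  have hdisj : Disjoint (D.incidenceFinset x ∪ D.incidenceFinset y ∪ D.incidenceFinset v)
      (avoid D v (x, y)) := by
    rw [disjoint_left]
    intro e he he'
    rw [mem_avoid] at he'
    rw [mem_union, mem_union, SimpleGraph.mem_incidenceFinset, SimpleGraph.mem_incidenceFinset,
      SimpleGraph.mem_incidenceFinset] at he
    rcases he with (hm | hm) | hm
    · exact he'.2.2.1 hm.2
    · exact he'.2.2.2 hm.2
    · exact he'.2.1 hm.2
  have h4 : (D.incidenceFinset x ∪ D.incidenceFinset y ∪ D.incidenceFinset v ∪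
      avoid D v (x, y)).card ≤ D.edgeFinset.card := by
    apply card_le_card
    refine union_subset (union_subset (union_subset (D.incidenceFinset_subset x)
      (D.incidenceFinset_subset y)) (D.incidenceFinset_subset v)) ?_
    intro e he
    exact ((mem_avoid D v (x, y) e).mp he).1
  rw [card_union_of_disjoint hdisj] at h4
  rw [deg_eq_card_incidenceFinset, deg_eq_card_incidenceFinset, deg_eq_card_incidenceFinset]
  split_ifs at h3 ⊢ <;> omega

/-- **The sum over the pairs off `v` with the defects:** `S_R + |R|·d + Y ≤ |R|(m + 1) + 2E₁`. -/
theorem sum_R_add_sum_avoid_le (D : SimpleGraph V) [DecidableRel D.Adj] (v : V) :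
    ∑ p ∈ offPairs D v, (deg D p.1 + deg D p.2) + (offPairs D v).card * deg D v +
        ∑ p ∈ offPairs D v, (avoid D v p).card ≤
      (offPairs D v).card * D.edgeFinset.card + (offPairs D v).card +
        2 * ((offPairs D v).filter (fun p => D.Adj v p.1)).card := by
  have h : ∑ p ∈ offPairs D v, (deg D p.1 + deg D p.2 + deg D v + (avoid D v p).card) ≤
      ∑ p ∈ offPairs D v, (D.edgeFinset.card + 1 + (if D.Adj v p.1 then 1 else 0) +
        (if D.Adj v p.2 then 1 else 0)) := by
    apply sum_le_sum
    intro p hp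
    rw [mem_offPairs] at hp
    exact deg_add_deg_add_deg_add_card_avoid_le D hp.1 hp.2.1 hp.2.2
  simp only [sum_add_distrib, sum_const, smul_eq_mul] at h
  rw [← card_filter, ← card_filter, ← card_E_fst_eq_snd, mul_one] at h
  rw [sum_add_distrib]
  omega

/-! ### The matching pairs meeting a vertex -/

/-- A matching pair is determined by its first coordinate: at most one starts at `u`. -/
theorem card_filter_T_fst_le_one (D : SimpleGraph V) [DecidableRel D.Adj] (hK : K4mFree D) (v u : V) :
    (((offPairs D v).filter (fun p => D.Adj v p.1 ∧ D.Adj v p.2)).filter (fun q => q.1 = u)).card ≤ 1 := by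
  rw [card_le_one]
  intro q hq q' hq'
  rw [mem_filter, mem_filter, mem_offPairs] at hq hq'
  obtain ⟨⟨⟨hq12, -, -⟩, hvq1, hvq2⟩, hqu⟩ := hq
  obtain ⟨⟨⟨hq12', -, -⟩, -, hvq2'⟩, hqu'⟩ := hq'
  have hle := card_filter_adj_neighbors_le_one D hK hvq1
  rw [card_le_one] at hle
  have ha : q.2 ∈ (univ.filter (fun x => D.Adj v x)).filter (fun x => D.Adj q.1 x) :=
    mem_filter.mpr ⟨mem_filter.mpr ⟨mem_univ _, hvq2⟩, hq12⟩
  have hb : q'.2 ∈ (univ.filter (fun x => D.Adj v x)).filter (fun x => D.Adj q.1 x) :=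
    mem_filter.mpr ⟨mem_filter.mpr ⟨mem_univ _, hvq2'⟩, (hqu.trans hqu'.symm) ▸ hq12'⟩
  exact Prod.ext (hqu.trans hqu'.symm) (hle _ ha _ hb)

/-- A matching pair is determined by its second coordinate: at most one ends at `u`. -/
theorem card_filter_T_snd_le_one (D : SimpleGraph V) [DecidableRel D.Adj] (hK : K4mFree D) (v u : V) :
    (((offPairs D v).filter (fun p => D.Adj v p.1 ∧ D.Adj v p.2)).filter (fun q => q.2 = u)).card ≤ 1 := by
  rw [card_le_one]
  intro q hq q' hq'
  rw [mem_filter, mem_filter, mem_offPairs] at hq hq'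
  obtain ⟨⟨⟨hq12, -, -⟩, hvq1, hvq2⟩, hqu⟩ := hq
  obtain ⟨⟨⟨hq12', -, -⟩, hvq1', -⟩, hqu'⟩ := hq'
  have hle := card_filter_adj_neighbors_le_one D hK hvq2
  rw [card_le_one] at hle
  have ha : q.1 ∈ (univ.filter (fun x => D.Adj v x)).filter (fun x => D.Adj q.2 x) :=
    mem_filter.mpr ⟨mem_filter.mpr ⟨mem_univ _, hvq1⟩, hq12.symm⟩
  have hb : q'.1 ∈ (univ.filter (fun x => D.Adj v x)).filter (fun x => D.Adj q.2 x) :=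
    mem_filter.mpr ⟨mem_filter.mpr ⟨mem_univ _, hvq1'⟩, (hqu.trans hqu'.symm) ▸ hq12'.symm⟩
  exact Prod.ext (hle _ ha _ hb) (hqu.trans hqu'.symm)

/-- At most two matching pairs meet a given vertex `u`. -/
theorem card_filter_T_meets_le_two (D : SimpleGraph V) [DecidableRel D.Adj] (hK : K4mFree D) (v u : V) :
    (((offPairs D v).filter (fun p => D.Adj v p.1 ∧ D.Adj v p.2)).filter
      (fun q => q.1 = u ∨ q.2 = u)).card ≤ 2 := by
  rw [filter_or]
  refine (card_union_le _ _).trans ?_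
  have h1 := card_filter_T_fst_le_one D hK v u
  have h2 := card_filter_T_snd_le_one D hK v u
  omega

/-- A matching pair `q` whose first coordinate is off a matching pair `p` has its second coordinate off `p`
too (the matching property at `p.1` and `p.2`). -/
theorem snd_ne_of_mem_T_of_fst_ne (D : SimpleGraph V) [DecidableRel D.Adj] (hK : K4mFree D) (v : V)
    {p q : V × V} (hp : p ∈ (offPairs D v).filter (fun p => D.Adj v p.1 ∧ D.Adj v p.2))
    (hq : q ∈ (offPairs D v).filter (fun p => D.Adj v p.1 ∧ D.Adj v p.2))
    (h1 : q.1 ≠ p.1) (h2 : q.1 ≠ p.2) : q.2 ≠ p.1 ∧ q.2 ≠ p.2 := by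
  rw [mem_filter, mem_offPairs] at hp hq
  obtain ⟨⟨hp12, -, -⟩, hvp1, hvp2⟩ := hp
  obtain ⟨⟨hq12, -, -⟩, hvq1, -⟩ := hq
  constructor
  · intro he
    have hle := card_filter_adj_neighbors_le_one D hK hvp1
    rw [card_le_one] at hle
    have ha : q.1 ∈ (univ.filter (fun x => D.Adj v x)).filter (fun x => D.Adj p.1 x) :=
      mem_filter.mpr ⟨mem_filter.mpr ⟨mem_univ _, hvq1⟩, he ▸ hq12.symm⟩
    have hb : p.2 ∈ (univ.filter (fun x => D.Adj v x)).filter (fun x => D.Adj p.1 x) :=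
      mem_filter.mpr ⟨mem_filter.mpr ⟨mem_univ _, hvp2⟩, hp12⟩
    exact h2 (hle _ ha _ hb)
  · intro he
    have hle := card_filter_adj_neighbors_le_one D hK hvp2
    rw [card_le_one] at hle
    have ha : q.1 ∈ (univ.filter (fun x => D.Adj v x)).filter (fun x => D.Adj p.2 x) :=
      mem_filter.mpr ⟨mem_filter.mpr ⟨mem_univ _, hvq1⟩, he ▸ hq12.symm⟩
    have hb : p.1 ∈ (univ.filter (fun x => D.Adj v x)).filter (fun x => D.Adj p.2 x) :=
      mem_filter.mpr ⟨mem_filter.mpr ⟨mem_univ _, hvp1⟩, hp12.symm⟩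
    exact h1 (hle _ ha _ hb)

/-- With `T ≥ 3` matching pairs and a vertex `u ∉ N(v)`, some matching pair avoids `u` and any given `u'`. -/
theorem exists_T_avoiding_of_not_adj (D : SimpleGraph V) [DecidableRel D.Adj] (hK : K4mFree D) (v : V)
    (h3 : 3 ≤ ((offPairs D v).filter (fun p => D.Adj v p.1 ∧ D.Adj v p.2)).card)
    {u : V} (hu : ¬ D.Adj v u) (u' : V) :
    ∃ q ∈ (offPairs D v).filter (fun p => D.Adj v p.1 ∧ D.Adj v p.2),
      q.1 ≠ u ∧ q.1 ≠ u' ∧ q.2 ≠ u ∧ q.2 ≠ u' := by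
  have hlt : (((offPairs D v).filter (fun p => D.Adj v p.1 ∧ D.Adj v p.2)).filter
      (fun q => q.1 = u' ∨ q.2 = u')).card <
      ((offPairs D v).filter (fun p => D.Adj v p.1 ∧ D.Adj v p.2)).card := by
    have := card_filter_T_meets_le_two D hK v u'
    omega
  obtain ⟨q, hq, hqF⟩ := exists_mem_notMem_of_card_lt_card hlt
  rw [mem_filter, not_and] at hqF
  have hq' : ¬ (q.1 = u' ∨ q.2 = u') := hqF hq
  push Not at hq'
  rw [mem_filter] at hq
  refine ⟨q, mem_filter.mpr hq, ?_, hq'.1, ?_, hq'.2⟩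
  · intro he
    exact hu (he ▸ hq.2.1)
  · intro he
    exact hu (he ▸ hq.2.2)

/-- **With `T ≥ 3` every pair off `v` has a matching pair avoiding both its coordinates.** -/
theorem exists_T_avoiding (D : SimpleGraph V) [DecidableRel D.Adj] (hK : K4mFree D) (v : V)
    (h3 : 3 ≤ ((offPairs D v).filter (fun p => D.Adj v p.1 ∧ D.Adj v p.2)).card)
    {p : V × V} (hp : p ∈ offPairs D v) :
    ∃ q ∈ (offPairs D v).filter (fun p => D.Adj v p.1 ∧ D.Adj v p.2),
      q.1 ≠ p.1 ∧ q.1 ≠ p.2 ∧ q.2 ≠ p.1 ∧ q.2 ≠ p.2 := by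
  by_cases hT : D.Adj v p.1 ∧ D.Adj v p.2
  · exact exists_disjoint_matching_pair D hK v h3 (mem_filter.mpr ⟨hp, hT⟩)
  · rw [not_and_or] at hT
    rcases hT with h1 | h2
    · exact exists_T_avoiding_of_not_adj D hK v h3 h1 p.2
    · obtain ⟨q, hq, hq1, hq2, hq3, hq4⟩ := exists_T_avoiding_of_not_adj D hK v h3 h2 p.1
      exact ⟨q, hq, hq2, hq1, hq4, hq3⟩

/-- The edge of a matching pair avoiding `p` is in `avoid D v p`. -/
theorem mk_mem_avoid_of_T (D : SimpleGraph V) [DecidableRel D.Adj] (v : V) {p q : V × V}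
    (hq : q ∈ (offPairs D v).filter (fun p => D.Adj v p.1 ∧ D.Adj v p.2))
    (h1 : q.1 ≠ p.1) (h2 : q.1 ≠ p.2) (h3 : q.2 ≠ p.1) (h4 : q.2 ≠ p.2) :
    s(q.1, q.2) ∈ avoid D v p := by
  rw [mem_filter, mem_offPairs] at hq
  obtain ⟨⟨hq12, hq1v, hq2v⟩, -⟩ := hq
  rw [mem_avoid]
  refine ⟨SimpleGraph.mem_edgeFinset.mpr hq12, ?_, ?_, ?_⟩
  · intro hm
    rcases Sym2.mem_iff.mp hm with hm | hm
    · exact hq1v hm.symm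
    · exact hq2v hm.symm
  · intro hm
    rcases Sym2.mem_iff.mp hm with hm | hm
    · exact h1 hm.symm
    · exact h3 hm.symm
  · intro hm
    rcases Sym2.mem_iff.mp hm with hm | hm
    · exact h2 hm.symm
    · exact h4 hm.symm

/-- With `T ≥ 3` every pair off `v` has a non-empty `avoid` set. -/
theorem one_le_card_avoid_of_three_le (D : SimpleGraph V) [DecidableRel D.Adj] (hK : K4mFree D) (v : V)
    (h3 : 3 ≤ ((offPairs D v).filter (fun p => D.Adj v p.1 ∧ D.Adj v p.2)).card)
    {p : V × V} (hp : p ∈ offPairs D v) : 1 ≤ (avoid D v p).card := by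
  obtain ⟨q, hq, hq1, hq2, hq3, hq4⟩ := exists_T_avoiding D hK v h3 hp
  exact card_pos.mpr ⟨_, mk_mem_avoid_of_T D v hq hq1 hq2 hq3 hq4⟩

/-- **`|R| ≤ Y` with `T ≥ 3`.** -/
theorem card_offPairs_le_sum_avoid_of_three_le (D : SimpleGraph V) [DecidableRel D.Adj] (hK : K4mFree D)
    (v : V) (h3 : 3 ≤ ((offPairs D v).filter (fun p => D.Adj v p.1 ∧ D.Adj v p.2)).card) :
    (offPairs D v).card ≤ ∑ p ∈ offPairs D v, (avoid D v p).card := by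
  have := card_nsmul_le_sum (offPairs D v) (fun p => (avoid D v p).card) 1
    (fun p hp => one_le_card_avoid_of_three_le D hK v h3 hp)
  rw [smul_eq_mul, mul_one] at this
  exact this

/-- **With `T ≥ 6` every matching pair has two distinct matching edges avoiding it.** -/
theorem two_le_card_avoid_of_six_le (D : SimpleGraph V) [DecidableRel D.Adj] (hK : K4mFree D) (v : V)
    (h6 : 6 ≤ ((offPairs D v).filter (fun p => D.Adj v p.1 ∧ D.Adj v p.2)).card)
    {p : V × V} (hp : p ∈ (offPairs D v).filter (fun p => D.Adj v p.1 ∧ D.Adj v p.2)) :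
    2 ≤ (avoid D v p).card := by
  set Tset := (offPairs D v).filter (fun p => D.Adj v p.1 ∧ D.Adj v p.2) with hTset
  -- the matching pairs starting off `p` number at least `T − 2`
  have hsplit := card_filter_add_card_filter_not (s := Tset) (fun q => q.1 = p.1 ∨ q.1 = p.2)
  have hF : (Tset.filter (fun q => q.1 = p.1 ∨ q.1 = p.2)).card ≤ 2 := by
    rw [filter_or]
    refine (card_union_le _ _).trans ?_
    have h1 := card_filter_T_fst_le_one D hK v p.1
    have h2 := card_filter_T_fst_le_one D hK v p.2
    rw [← hTset] at h1 h2
    omega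
  set Q := Tset.filter (fun q => ¬ (q.1 = p.1 ∨ q.1 = p.2)) with hQ
  have hQ4 : 4 ≤ Q.card := by omega
  -- a first one
  obtain ⟨q₁, hq₁⟩ : Q.Nonempty := card_pos.mp (by omega)
  -- a second one, neither `q₁` nor its swap
  have hQ' : 0 < ((Q.erase q₁).erase q₁.swap).card := by
    have e1 := pred_card_le_card_erase (s := Q) (a := q₁)
    have e2 := pred_card_le_card_erase (s := Q.erase q₁) (a := q₁.swap)
    omega
  obtain ⟨q₂, hq₂⟩ := card_pos.mp hQ'
  rw [mem_erase, mem_erase] at hq₂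
  obtain ⟨hq₂s, hq₂₁, hq₂Q⟩ := hq₂
  -- unpack membership in `Q`
  have hmemQ : ∀ q ∈ Q, q ∈ Tset ∧ q.1 ≠ p.1 ∧ q.1 ≠ p.2 := by
    intro q hq
    rw [hQ, mem_filter] at hq
    push Not at hq
    exact ⟨hq.1, hq.2.1, hq.2.2⟩
  obtain ⟨hq₁T, hq₁1, hq₁2⟩ := hmemQ q₁ hq₁
  obtain ⟨hq₂T, hq₂1, hq₂2⟩ := hmemQ q₂ hq₂Q
  obtain ⟨hq₁3, hq₁4⟩ := snd_ne_of_mem_T_of_fst_ne D hK v hp hq₁T hq₁1 hq₁2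
  obtain ⟨hq₂3, hq₂4⟩ := snd_ne_of_mem_T_of_fst_ne D hK v hp hq₂T hq₂1 hq₂2
  have he₁ := mk_mem_avoid_of_T D v hq₁T hq₁1 hq₁2 hq₁3 hq₁4
  have he₂ := mk_mem_avoid_of_T D v hq₂T hq₂1 hq₂2 hq₂3 hq₂4
  -- the two edges are distinct
  have hne : s(q₁.1, q₁.2) ≠ s(q₂.1, q₂.2) := by
    intro he
    rw [Sym2.eq_iff] at he
    rcases he with ⟨h1, h2⟩ | ⟨h1, h2⟩
    · exact hq₂₁ (Prod.ext h1.symm h2.symm)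
    · exact hq₂s (Prod.ext h2.symm h1.symm)
  have hsub : ({s(q₁.1, q₁.2), s(q₂.1, q₂.2)} : Finset (Sym2 V)) ⊆ avoid D v p := by
    intro e he
    rw [mem_insert, mem_singleton] at he
    rcases he with rfl | rfl
    · exact he₁
    · exact he₂
  have := card_le_card hsub
  rw [card_pair hne] at this
  exact this

/-- **`2T ≤ Y` with `T ≥ 6`.** -/
theorem two_mul_card_T_le_sum_avoid_of_six_le (D : SimpleGraph V) [DecidableRel D.Adj] (hK : K4mFree D)
    (v : V) (h6 : 6 ≤ ((offPairs D v).filter (fun p => D.Adj v p.1 ∧ D.Adj v p.2)).card) :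
    2 * ((offPairs D v).filter (fun p => D.Adj v p.1 ∧ D.Adj v p.2)).card ≤
      ∑ p ∈ offPairs D v, (avoid D v p).card := by
  have h1 := card_nsmul_le_sum ((offPairs D v).filter (fun p => D.Adj v p.1 ∧ D.Adj v p.2))
    (fun p => (avoid D v p).card) 2 (fun p hp => two_le_card_avoid_of_six_le D hK v h6 hp)
  have h2 : ∑ p ∈ (offPairs D v).filter (fun p => D.Adj v p.1 ∧ D.Adj v p.2), (avoid D v p).card ≤
      ∑ p ∈ offPairs D v, (avoid D v p).card :=
    sum_le_sum_of_subset (filter_subset _ _)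
  rw [smul_eq_mul] at h1
  omega

end C047

end TriangleCap

end PercRepro
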